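import Summits.QuantumFields.YangMills.Theorems.BalabanUVNodesN15CovariantLandauFlatRowsKing
import HarnessLib

/-!
# Route «BalabanUVNodes», node N15 = NE2, road (c) — PROGRAMME (P-S), XV: THE LEIBNIZ ALGEBRA OF THE COVARIANT GRADIENT — `∂ − D_T = n·𝔇_{1−T}·S`, the divergence of a
# bond-multiplied shifted field `∂ᵀ(𝔇_W S f) = 𝔰(div_n W)·f − ℭ_W·∂f`, and the second-order expansion `Δ′(1) − Δ′(T) = ∂ᵀB + Bᵀ∂ − BᵀB + a(Q′₁ᵀQ′₁ − Q′_TᵀQ′_T)` — the identities by which the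
# Calderón–Zygmund word `∂G′(1)∂ᵀ` is AVOIDED in the covariant gradient row (dag-n15-c g23, n15-c∕224; HOME HANDOFF «g23 ANALYSIS»)

Cell `pub-ymgap`, seat `pub-ymgap-dag-n15-c` (generation g23; R134 (a), s1; HUMAN RULING D-0062; chair R424 venue).  `bears_on: R4∕N15 · K3⁸ SpineGivenEndpointR13SepCoPHV
(stmt-QuantumFields-27366)`; filed `--supports stmt-QuantumFields-27366 --as helper` — COUNT-NEUTRAL.  Five bookkeeping `def`s (local operators) + theorems; 0 `sorry`; pure finite-dimensional
algebra.  Imports BY NAME n15-c∕197 (`cgrad`, `csavg`, `claplA`, `cgrad_mulVec`, `cgrad_one`), n15-c∕220 (`gradFlat_transpose_mulVec`, `mulVecLin_kronecker_one_rect`).  Nothing in the tree is modified.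

WHY (HOME HANDOFF g23 ANALYSIS).  After n15-c∕223 the Landau letter's one-grid rows rest on ONE displayed row per grid, `D_TG′(T) − ∂G′(1)`.  Bootstrapping it by the resolvent identity meets
`∂G′(1)∂ᵀ·(∂ − D_T)G′(T)`, and the sup-block row of the Calderón–Zygmund word `∂G′(1)∂ᵀ` is `~ log n`.  But `(∂ − D_T)f = n(1 − T)·Sf` is a bond MULTIPLIER times a shift, and the flat
divergence obeys a LEIBNIZ rule: `∂ᵀ(𝔇_W·Sf)(z) = Σ_μ n(W_μ(z−e_μ) − W_μ(z))·f(z) − Σ_μ W_μ(z)·(∂f)(z, μ)`; so `∂G′(1)∂ᵀ(∂ − D_T)G′(T) = ∂G′(1)·[𝔰(div_n W) − ℭ_W ∂]G′(T)` with `W = n(1 − T)`: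
only `∂G′(1)` (row PROVED, n15-c∕220), the multiplier `div_n W ~ n²∇T = O(r)` (Reg335's (3.35) second member makes `T` Lipschitz-small) and the contraction `ℭ_W ~ r` appear — no CZ word.
THIS FILE is the algebra: the local operators and the three identities, at the matrix level.
* §1 `bShift` (`S`), `bDiag` (`𝔇_W`), `bContr` (`ℭ_W`), `sDiag` (`𝔰_V`), `bDiv` (`div_n W`) with their `mulVec` formulas; `eq_of_mulVec_eq'`.
* §2 ★ `cgrad_one_sub_cgrad_mulVec` — `∂ − D_T = n·𝔇_{1−T}·S`; ★★ `cgrad_one_transpose_mulVec_bDiag_bShift` — the Leibniz rule; ★ `claplA_one_sub_claplA` — the second-order expansion (identities stated as actions on fields: with `CStarMatrix` in scope rectangular `*` elaborates ambiguously).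

HONEST FRAMING ∕ LIMITS.  Finite-dimensional identities ([folklore]); the located g24 programme «the covariant gradient row by Leibniz, no Hölder norms» needs, beyond this file, the
Lipschitz letter of `coordMat e Ad_{e^{A/n}}` from (3.35)'s second member and a joint Neumann bootstrap for `(G′(T), ∂G′(T))` (not here); NOT [Balaban1985BackgroundPropagators] Lemma 3.3 ∕
Thm 3.4 as printed; NE2⁺ NOT PRINTED; N15 of record untouched (DISCHARGED AS CONSUMED, p687738); counts UNMOVED (typed 28∕28 · discharged 8∕27); one finite 𝕋⁴ at fixed ε per index — NOT
infinite volume ∕ OS ∕ mass gap ∕ Clay.  Restate-immune (no Theses import).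
-/

noncomputable section

open scoped BigOperators Matrix

namespace Summit.QuantumFields.YangMills.BalabanUVNodes.N15.CovLandau

open Literature.MathematicalPhysics.QuantumFieldTheory.Balaban1983to89
open Literature.MathematicalPhysics.QuantumFieldTheory.Balaban1983to89.B5Prop11Plancherel (Tor fine unitVec)
open Summit.QuantumFields.YangMills.BalabanUVNodes.N15.VectorPiece (tensorId tensorId_apply)

variable {d : ℕ}

section Local

variable (M : Fin (d + 1) → ℕ) [∀ μ, NeZero (M μ)] (n : ℕ) [NeZero n] {ι : Type} [Fintype ι] [DecidableEq ι]

/-! ## §1 The local operators -/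

/-- THE SHIFT-EVALUATION `S`: `(Sf)((x, ν), i) = f(x + e_ν, i)` (site fields to bond fields). [folklore] -/
def bShift : Matrix ((Tor (fine n M) × Fin (d + 1)) × ι) (Tor (fine n M) × ι) ℝ :=
  fun p q => if q.1 = p.1.1 + unitVec (fine n M) p.1.2 then (if q.2 = p.2 then 1 else 0) else 0

/-- THE BOND MULTIPLIER `𝔇_W`: `(𝔇_W ω)((x, ν), i) = Σ_j W_ν(x)_{ij} ω((x, ν), j)`. [folklore] -/
def bDiag (W : Fin (d + 1) → Tor (fine n M) → Matrix ι ι ℝ) : Matrix ((Tor (fine n M) × Fin (d + 1)) × ι) ((Tor (fine n M) × Fin (d + 1)) × ι) ℝ :=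
  fun p q => if q.1 = p.1 then W p.1.2 p.1.1 p.2 q.2 else 0

/-- THE CONTRACTION `ℭ_W`: `(ℭ_W ω)(z, i) = Σ_μ Σ_j W_μ(z)_{ij} ω((z, μ), j)` (bond fields to site fields). [folklore] -/
def bContr (W : Fin (d + 1) → Tor (fine n M) → Matrix ι ι ℝ) : Matrix (Tor (fine n M) × ι) ((Tor (fine n M) × Fin (d + 1)) × ι) ℝ :=
  fun q p => if p.1.1 = q.1 then W p.1.2 q.1 q.2 p.2 else 0

/-- THE SITE MULTIPLIER `𝔰_V`: `(𝔰_V f)(z, i) = Σ_j V(z)_{ij} f(z, j)`. [folklore] -/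
def sDiag (V : Tor (fine n M) → Matrix ι ι ℝ) : Matrix (Tor (fine n M) × ι) (Tor (fine n M) × ι) ℝ :=
  fun q q' => if q'.1 = q.1 then V q.1 q.2 q'.2 else 0

/-- THE LATTICE DIVERGENCE OF A BOND MULTIPLIER: `(div_n W)(z) = Σ_μ n·(W_μ(z − e_μ) − W_μ(z))`. [folklore] -/
def bDiv (W : Fin (d + 1) → Tor (fine n M) → Matrix ι ι ℝ) : Tor (fine n M) → Matrix ι ι ℝ :=
  fun z => ∑ μ, (n : ℝ) • (W μ (z - unitVec (fine n M) μ) - W μ z)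

/-- `S` pointwise. [folklore] -/
theorem bShift_mulVec (f : Tor (fine n M) × ι → ℝ) (x : Tor (fine n M)) (ν : Fin (d + 1)) (i : ι) :
    (bShift M n *ᵥ f) ((x, ν), i) = f (x + unitVec (fine n M) ν, i) := by
  classical
  simp only [Matrix.mulVec, dotProduct, bShift]
  rw [Fintype.sum_prod_type]
  simp only [ite_mul, one_mul, zero_mul]
  rw [Finset.sum_eq_single (x + unitVec (fine n M) ν) (fun z _ hz => by simp [hz]) (fun h => absurd (Finset.mem_univ _) h)]
  simp

omit [DecidableEq ι] in
/-- `𝔇_W` pointwise. [folklore] -/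
theorem bDiag_mulVec (W : Fin (d + 1) → Tor (fine n M) → Matrix ι ι ℝ) (ω : (Tor (fine n M) × Fin (d + 1)) × ι → ℝ) (b : Tor (fine n M) × Fin (d + 1)) (i : ι) :
    (bDiag M n W *ᵥ ω) (b, i) = ∑ j, W b.2 b.1 i j * ω (b, j) := by
  classical
  simp only [Matrix.mulVec, dotProduct, bDiag]
  rw [Fintype.sum_prod_type]
  simp only [ite_mul, zero_mul]
  rw [Finset.sum_eq_single b (fun b' _ hb => by simp [hb]) (fun h => absurd (Finset.mem_univ _) h)]
  simp

omit [DecidableEq ι] in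
/-- `ℭ_W` pointwise. [folklore] -/
theorem bContr_mulVec (W : Fin (d + 1) → Tor (fine n M) → Matrix ι ι ℝ) (ω : (Tor (fine n M) × Fin (d + 1)) × ι → ℝ) (z : Tor (fine n M)) (i : ι) :
    (bContr M n W *ᵥ ω) (z, i) = ∑ μ, ∑ j, W μ z i j * ω ((z, μ), j) := by
  classical
  simp only [Matrix.mulVec, dotProduct, bContr]
  rw [Fintype.sum_prod_type, Fintype.sum_prod_type]
  simp only [ite_mul, zero_mul]
  rw [Finset.sum_eq_single z (fun x _ hx => by simp [hx]) (fun h => absurd (Finset.mem_univ _) h)]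
  simp

omit [DecidableEq ι] in
/-- `𝔰_V` pointwise. [folklore] -/
theorem sDiag_mulVec (V : Tor (fine n M) → Matrix ι ι ℝ) (f : Tor (fine n M) × ι → ℝ) (z : Tor (fine n M)) (i : ι) :
    (sDiag M n V *ᵥ f) (z, i) = ∑ j, V z i j * f (z, j) := by
  classical
  simp only [Matrix.mulVec, dotProduct, sDiag]
  rw [Fintype.sum_prod_type]
  simp only [ite_mul, zero_mul]
  rw [Finset.sum_eq_single z (fun x _ hx => by simp [hx]) (fun h => absurd (Finset.mem_univ _) h)]
  simp

omit [∀ μ, NeZero (M μ)] [NeZero n] [DecidableEq ι] in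
/-- Two real matrices with the same action agree. [folklore] -/
theorem eq_of_mulVec_eq' {X Y : Type} [Fintype X] [DecidableEq X] [Fintype Y] {A B : Matrix Y X ℝ} (h : ∀ f : X → ℝ, A *ᵥ f = B *ᵥ f) : A = B := by
  ext i j
  have hij := congrFun (h (Pi.single j 1)) i
  simpa [Matrix.mulVec, dotProduct, Pi.single_apply, mul_ite] using hij

/-- The transposed covariant gradient at `T ≡ 1` pointwise: `(∂ᵀω)(z, i) = Σ_μ n·(ω((z − e_μ, μ), i) − ω((z, μ), i))`. [cite: Balaban1984PropagatorsI, (1.4) p.18] -/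
theorem cgrad_one_transpose_mulVec (ω : (Tor (fine n M) × Fin (d + 1)) × ι → ℝ) (z : Tor (fine n M)) (i : ι) :
    ((cgrad M n (fun (_ : Fin (d + 1)) (_ : Tor (fine n M)) => (1 : Matrix ι ι ℝ)))ᵀ *ᵥ ω) (z, i) =
      ∑ μ, (n : ℝ) * (ω ((z - unitVec (fine n M) μ, μ), i) - ω ((z, μ), i)) := by
  rw [cgrad_one, ← Matrix.kroneckerMap_transpose, Matrix.transpose_one, ← Matrix.mulVecLin_apply, mulVecLin_kronecker_one_rect, tensorId_apply, Matrix.mulVecLin_apply,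
    gradFlat_transpose_mulVec]

/-! ## §2 The three identities -/

/-- ★ **`∂ − D_T = n·𝔇_{1−T}·S`** (as actions on fields): the covariant gradient differs from the flat one by a bond multiplier of the shifted field.
[cite: Balaban1985BackgroundPropagators, (3.21) p.394] -/
theorem cgrad_one_sub_cgrad_mulVec (T : Fin (d + 1) → Tor (fine n M) → Matrix ι ι ℝ) (f : Tor (fine n M) × ι → ℝ) :
    ((cgrad M n (fun (_ : Fin (d + 1)) (_ : Tor (fine n M)) => (1 : Matrix ι ι ℝ))) - cgrad M n T) *ᵥ f = (n : ℝ) • (bDiag M n (fun ν x => 1 - T ν x) *ᵥ (bShift M n *ᵥ f)) := by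
  funext p
  obtain ⟨⟨x, ν⟩, i⟩ := p
  simp only [Matrix.sub_mulVec, Pi.sub_apply, Pi.smul_apply, smul_eq_mul, bDiag_mulVec, bShift_mulVec, cgrad_mulVec, Matrix.sub_apply, Matrix.one_apply, sub_mul, ite_mul,
    one_mul, zero_mul, Finset.sum_sub_distrib, Finset.sum_ite_eq, Finset.mem_univ, if_true]
  ring

/-- ★★ **THE LEIBNIZ RULE FOR THE FLAT DIVERGENCE OF A BOND-MULTIPLIED SHIFTED FIELD** (as actions on fields): `∂ᵀ(𝔇_W(Sf)) = 𝔰(div_n W)f − ℭ_W(∂f)` — the identity that trades the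
Calderón–Zygmund word `∂G′∂ᵀ` for `∂G′·𝔰(div_n W)` and `∂G′·ℭ_W·∂`. [cite: Balaban1985BackgroundPropagators, (3.58)–(3.62) p.402 (where the smoothness of the field enters)] -/
theorem cgrad_one_transpose_mulVec_bDiag_bShift (W : Fin (d + 1) → Tor (fine n M) → Matrix ι ι ℝ) (f : Tor (fine n M) × ι → ℝ) :
    (cgrad M n (fun (_ : Fin (d + 1)) (_ : Tor (fine n M)) => (1 : Matrix ι ι ℝ)))ᵀ *ᵥ (bDiag M n W *ᵥ (bShift M n *ᵥ f)) = sDiag M n (bDiv M n W) *ᵥ f - bContr M n W *ᵥ ((cgrad M n (fun (_ : Fin (d + 1)) (_ : Tor (fine n M)) => (1 : Matrix ι ι ℝ))) *ᵥ f) := by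
  funext p
  obtain ⟨z, i⟩ := p
  simp only [Pi.sub_apply, cgrad_one_transpose_mulVec, sDiag_mulVec, bContr_mulVec, bDiag_mulVec, bShift_mulVec, cgrad_mulVec, Matrix.one_apply, ite_mul, one_mul, zero_mul,
    Finset.sum_ite_eq, Finset.mem_univ, if_true, sub_add_cancel, bDiv, Matrix.sum_apply, Matrix.smul_apply, Matrix.sub_apply, smul_eq_mul, Finset.sum_mul]
  have h1 : (∑ j, ∑ μ, (n : ℝ) * (W μ (z - unitVec (fine n M) μ) i j - W μ z i j) * f (z, j)) =
      ∑ μ, ∑ j, (n : ℝ) * (W μ (z - unitVec (fine n M) μ) i j - W μ z i j) * f (z, j) := Finset.sum_comm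
  rw [h1, ← Finset.sum_sub_distrib]
  refine Finset.sum_congr rfl fun μ _ => ?_
  rw [← Finset.sum_sub_distrib, ← Finset.sum_sub_distrib, Finset.mul_sum]
  refine Finset.sum_congr rfl fun j _ => ?_
  ring

/-- ★ **THE SECOND-ORDER EXPANSION**: with `B = ∂ − D_T`, `Δ′_a(1) − Δ′_a(T) = ∂ᵀB + Bᵀ∂ − BᵀB + a(Q′₁ᵀQ′₁ − Q′_TᵀQ′_T)`. [cite: Balaban1985BackgroundPropagators, (3.24) p.394] -/
theorem claplA_one_sub_claplA (T : Fin (d + 1) → Tor (fine n M) → Matrix ι ι ℝ) (a : ℝ) :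
    claplA M n (fun (_ : Fin (d + 1)) (_ : Tor (fine n M)) => (1 : Matrix ι ι ℝ)) a - claplA M n T a =
      (cgrad M n (fun (_ : Fin (d + 1)) (_ : Tor (fine n M)) => (1 : Matrix ι ι ℝ)))ᵀ * (cgrad M n (fun (_ : Fin (d + 1)) (_ : Tor (fine n M)) => (1 : Matrix ι ι ℝ)) - cgrad M n T)
        + (cgrad M n (fun (_ : Fin (d + 1)) (_ : Tor (fine n M)) => (1 : Matrix ι ι ℝ)) - cgrad M n T)ᵀ * cgrad M n (fun (_ : Fin (d + 1)) (_ : Tor (fine n M)) => (1 : Matrix ι ι ℝ))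
        - (cgrad M n (fun (_ : Fin (d + 1)) (_ : Tor (fine n M)) => (1 : Matrix ι ι ℝ)) - cgrad M n T)ᵀ * (cgrad M n (fun (_ : Fin (d + 1)) (_ : Tor (fine n M)) => (1 : Matrix ι ι ℝ)) - cgrad M n T)
        + a • ((csavg M n (fun (_ : Fin (d + 1)) (_ : Tor (fine n M)) => (1 : Matrix ι ι ℝ)))ᵀ * csavg M n (fun (_ : Fin (d + 1)) (_ : Tor (fine n M)) => (1 : Matrix ι ι ℝ)) - (csavg M n T)ᵀ * csavg M n T) := by
  simp only [claplA, Matrix.transpose_sub, Matrix.sub_mul, Matrix.mul_sub, smul_sub]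
  abel

end Local

end Summit.QuantumFields.YangMills.BalabanUVNodes.N15.CovLandau

end
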